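import Mathlib
import Summits.Ventures.PercRepro2.CoinTreeCore
import Summits.Ventures.PercRepro2.CoinOrTailAlg
import Summits.Ventures.PercRepro2.CoinOrTailDefs
import Summits.Ventures.PercRepro2.CoinOrTailCore
import Summits.Ventures.PercRepro2.CoinOrTail3Cells
import Summits.Ventures.PercRepro2.CoinOrTail3Alg
import Summits.Ventures.PercRepro2.CoinOrTail3Core

/-!
# The (3,2)-route OR-tail core with the FAR marker `p₁` — an instantiation check
(blind cell PercRepro2, night-2 g9; NIGHT2-DARC.md §36)

A concrete coin system on `Fin 10` (s = 0, p₁ = 1, p₂ = 2, p₃ = 3, q = 4, t₂ = 5, a = 6, w = 7,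
v = 8, t = 9): the two-route core `s → p₁ → p₂ → p₃ → a ← t₂ ← q ← s` (seven single-arc coins),
the entries `p₂ → v`, `a → v`, `q → w`, the arm `w → v`, `v → t` — twelve coins, all random.
The markers are `p₁` (the FIRST vertex of route 1 — two steps above the attachment point `p₃`)
and `t₂`; `darc_of_orTailTrees3` gives row 2′DARC at the arc `a → w` for every probability
vector — a core with a route of length 3 and a far marker, beyond every certificate computed so
far, as a one-line corollary.
-/

namespace Summit.Ventures.PercRepro2.Coin

namespace OrTail3Example

open Classical

/-- The twelve coins of the example. -/
def arcsEx : Fin 12 → Finset (Fin 10 × Fin 10)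
  | 0 => {(0, 1)}   -- s → p₁
  | 1 => {(1, 2)}   -- p₁ → p₂
  | 2 => {(2, 3)}   -- p₂ → p₃
  | 3 => {(0, 4)}   -- s → q
  | 4 => {(4, 5)}   -- q → t₂
  | 5 => {(3, 6)}   -- cρ : p₃ → a
  | 6 => {(5, 6)}   -- cτ : t₂ → a
  | 7 => {(2, 8)}   -- p₂ → v (entry from branch 1 into the head)
  | 8 => {(6, 8)}   -- a → v (entry from the tail)
  | 9 => {(4, 7)}   -- q → w (entry from branch 2 into w)
  | 10 => {(7, 8)}  -- arm w → v
  | 11 => {(8, 9)}  -- v → t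

/-- The tree coins of branch 1. -/
def c₁Ex : Fin 10 → Fin 12
  | 1 => 0
  | 2 => 1
  | 3 => 2
  | _ => 0

/-- The parent map of branch 1. -/
def par₁Ex : Fin 10 → Fin 10
  | 1 => 0
  | 2 => 1
  | 3 => 2
  | _ => 0

/-- The rank of branch 1. -/
def rk₁Ex : Fin 10 → ℕ
  | 1 => 1
  | 2 => 2
  | 3 => 3
  | _ => 0

/-- The tree coins of branch 2. -/
def c₂Ex : Fin 10 → Fin 12
  | 4 => 3
  | 5 => 4
  | _ => 0

/-- The parent map of branch 2. -/
def par₂Ex : Fin 10 → Fin 10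
  | 4 => 0
  | 5 => 4
  | _ => 0

/-- The rank of branch 2. -/
def rk₂Ex : Fin 10 → ℕ
  | 4 => 1
  | 5 => 2
  | _ => 0

/-- Every coin is a single arc, so `SameEnds` holds. -/
lemma sameEnds_ex : SameEnds arcsEx := by
  intro e xy hxy x'y' hx'y'
  fin_cases e <;> simp [arcsEx] at hxy hx'y' <;> subst hxy <;> subst hx'y' <;>
    exact ⟨Or.inl rfl, Or.inr rfl⟩

/-- Branch 1 `{p₁, p₂, p₃}` is an out-tree core of `s`. -/
lemma treeCore₁_ex : TreeCore arcsEx 0 {1, 2, 3} c₁Ex par₁Ex rk₁Ex where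
  tree := by decide
  par_mem := by decide
  rank := by decide
  into_C := by decide
  into_s := by decide
  s_notin := by decide

/-- Branch 2 `{q, t₂}` is an out-tree core of `s`. -/
lemma treeCore₂_ex : TreeCore arcsEx 0 {4, 5} c₂Ex par₂Ex rk₂Ex where
  tree := by decide
  par_mem := by decide
  rank := by decide
  into_C := by decide
  into_s := by decide
  s_notin := by decide

/-- The two branches and the tail `a = 6` (coins `5 : p₃ → a`, `6 : t₂ → a`) form an OR-tail
core with the attachment points `p₃ = 3`, `t₂ = 5`. -/
lemma orTailCore_ex : OrTailCore arcsEx 0 {1, 2, 3} {4, 5} 3 5 6 5 6 where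
  p_mem := by decide
  q_mem := by decide
  disj := by decide
  s_notin₁ := by decide
  s_notin₂ := by decide
  a_notin₁ := by decide
  a_notin₂ := by decide
  a_ne_s := by decide
  into₁ := by decide
  into₂ := by decide
  into_s := by decide
  into_a := by decide
  arcs_ρ := by decide
  arcs_τ := by decide
  ρτ_ne := by decide

/-- **Row 2′DARC at the arc `a → w` of the (3,2)-route core with the FAR marker `p₁` and the
adjacent marker `t₂`, for every probability vector** — no hypothesis beyond `IsProbVec`. -/
theorem darc_orTail3_example {R : Type*} [Field R] [LinearOrder R] [IsStrictOrderedRing R]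
    (pr : Fin 12 → R) (hp : IsProbVec pr) :
    DARC pr arcsEx 0 {9} 1 5 6 7 :=
  darc_of_orTailTrees3 pr hp sameEnds_ex orTailCore_ex treeCore₁_ex treeCore₂_ex (by decide)
    (j := 2) (by decide) (by decide) (by decide) (by decide) (by decide) (by decide)

end OrTail3Example

end Summit.Ventures.PercRepro2.Coin
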